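import Summits.KontsevichZagierPeriods.KontsevichZagierPeriods.Theorems.SoloInformedSegBaker
import HarnessLib
import HarnessLib.Audit

/-!
# SoloInformed — the span of points and segments: normal forms and the kernel property

Solo programme `solo-KontsevichZagierPeriods-informed`, session s112 (kernel project
«`SoloInformedKZPUpTo 1` unconditionally from the tree's kernel Baker theorem»), file 7.

`soloInformedSegSpan` is the subgroup of the formal group generated by the relations, the point
representations `[pt, a]` (`a ∈ ℚ̄ ∩ ℝ`) and the admissible segments `Seg(g, c)`.  Every element
has a NORMAL FORM `[pt, a] + Σ_k Seg(g_k, c_k)` modulo relations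
(`soloInformed_segNF_of_mem_segSpan`), whose `eval` is `a + Σ_k Re(g_k Log c_k)`; by the null
theorem (`soloInformed_ptRep_add_segRep_sum_mem_relations`, Baker) an element of the span with
`eval = 0` is a relation (`soloInformed_mem_relations_of_mem_segSpan`): **on the span, the period
conjecture holds** (`soloInformed_equivalent_of_mem_segSpan`).

References: M. Kontsevich, D. Zagier, *Periods* (2001), §1.2; A. Baker (1975), Thm. 2.1; this
work.
-/

noncomputable section

open scoped BigOperators ComplexConjugate
open MeasureTheory Set Filter
open Literature.ModelTheory.ExponentialFields
open Literature.NumberTheory.Transcendental Literature.NumberTheory.Transcendental.KZ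

namespace Summit.KontsevichZagierPeriods.KontsevichZagierPeriods.Theorems

/-! ### The span and its normal forms -/

/-- The generators: relations, point representations, admissible segment representations. -/
def soloInformedSegGen : Set FormalRep :=
  (relations : Set FormalRep) ∪
    {x | ∃ (a : ℝ) (ha : IsAlgebraic ℚ a), x = of (soloInformedPtRep a ha)} ∪
    {x | ∃ g c : ℂ, SoloInformedSegAdm g c ∧ x = of (soloInformedSegRep g c)}

/-- **The span of points and segments** (modulo relations). -/
def soloInformedSegSpan : AddSubgroup FormalRep :=
  AddSubgroup.closure soloInformedSegGen

/-- Relations lie in the span. -/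
theorem soloInformed_relations_le_segSpan : relations ≤ soloInformedSegSpan := fun _ hx =>
  AddSubgroup.subset_closure (Or.inl (Or.inl hx))

/-- Point representations lie in the span. -/
theorem soloInformed_ptRep_mem_segSpan (a : ℝ) (ha : IsAlgebraic ℚ a) :
    of (soloInformedPtRep a ha) ∈ soloInformedSegSpan :=
  AddSubgroup.subset_closure (Or.inl (Or.inr ⟨a, ha, rfl⟩))

/-- Admissible segments lie in the span. -/
theorem soloInformed_segRep_mem_segSpan {g c : ℂ} (h : SoloInformedSegAdm g c) :
    of (soloInformedSegRep g c) ∈ soloInformedSegSpan :=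
  AddSubgroup.subset_closure (Or.inr ⟨g, c, h, rfl⟩)

/-- The span is saturated for the relations: `x − y ∈ relations`, `y ∈ span` ⇒ `x ∈ span`. -/
theorem soloInformed_mem_segSpan_of_sub_mem {x y : FormalRep} (h : x - y ∈ relations)
    (hy : y ∈ soloInformedSegSpan) : x ∈ soloInformedSegSpan := by
  have := soloInformedSegSpan.add_mem (soloInformed_relations_le_segSpan h) hy
  simpa using this

/-- Finite sums of elements of the span. -/
theorem soloInformed_sum_mem_segSpan {ι : Type*} (s : Finset ι) {x : ι → FormalRep}
    (h : ∀ i ∈ s, x i ∈ soloInformedSegSpan) : ∑ i ∈ s, x i ∈ soloInformedSegSpan :=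
  sum_mem h

/-- **Normal forms**: `x ≡ [pt, a] + Σ_k Seg(g_k, c_k)` modulo relations. -/
def SoloInformedSegNF (x : FormalRep) : Prop :=
  ∃ (a : ℝ) (ha : IsAlgebraic ℚ a) (K : ℕ) (g c : Fin K → ℂ),
    (∀ k, SoloInformedSegAdm (g k) (c k)) ∧
    x - (of (soloInformedPtRep a ha) + ∑ k, of (soloInformedSegRep (g k) (c k))) ∈ relations

/-- Relations have the trivial normal form. -/
theorem soloInformed_segNF_of_mem_relations {x : FormalRep} (hx : x ∈ relations) :
    SoloInformedSegNF x := by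
  refine ⟨0, isAlgebraic_zero, 0, Fin.elim0, Fin.elim0, fun k => k.elim0, ?_⟩
  simpa using relations.sub_mem hx soloInformed_ptRep_zero_mem_relations

/-- Normal form of a point representation. -/
theorem soloInformed_segNF_ptRep (a : ℝ) (ha : IsAlgebraic ℚ a) :
    SoloInformedSegNF (of (soloInformedPtRep a ha)) := by
  refine ⟨a, ha, 0, Fin.elim0, Fin.elim0, fun k => k.elim0, ?_⟩
  simp

/-- Normal form of a segment. -/
theorem soloInformed_segNF_segRep {g c : ℂ} (h : SoloInformedSegAdm g c) :
    SoloInformedSegNF (of (soloInformedSegRep g c)) := by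
  refine ⟨0, isAlgebraic_zero, 1, fun _ => g, fun _ => c, fun _ => h, ?_⟩
  simpa using relations.neg_mem soloInformed_ptRep_zero_mem_relations

/-- Normal forms add (concatenate the families, add the constants). -/
theorem soloInformed_segNF_add {x y : FormalRep} (hx : SoloInformedSegNF x)
    (hy : SoloInformedSegNF y) : SoloInformedSegNF (x + y) := by
  obtain ⟨a, ha, K, g, c, hadm, hx⟩ := hx
  obtain ⟨b, hb, L, g', c', hadm', hy⟩ := hy
  refine ⟨a + b, ha.add hb, K + L, Fin.append g g', Fin.append c c', fun k => ?_, ?_⟩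
  · refine Fin.addCases (fun i => ?_) (fun j => ?_) k
    · simpa only [Fin.append_left] using hadm i
    · simpa only [Fin.append_right] using hadm' j
  · have hpt := soloInformed_ptRep_add_sub_mem_relations ha hb
    have := relations.sub_mem (relations.add_mem hx hy) hpt
    rw [Fin.sum_univ_add]
    simp only [Fin.append_left, Fin.append_right]
    convert this using 1
    abel

/-- Normal forms negate (negate the coefficients and the constant). -/
theorem soloInformed_segNF_neg {x : FormalRep} (hx : SoloInformedSegNF x) :
    SoloInformedSegNF (-x) := by
  obtain ⟨a, ha, K, g, c, hadm, hx⟩ := hx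
  refine ⟨-a, ha.neg, K, fun k => -g k, c, fun k => ⟨(hadm k).1.neg, (hadm k).2⟩, ?_⟩
  have hpt := soloInformed_ptRep_neg_add_mem_relations ha
  have hseg : ∑ k, (of (soloInformedSegRep (-g k) (c k)) + of (soloInformedSegRep (g k) (c k))) ∈
      relations :=
    sum_mem fun k _ => soloInformed_segRep_neg_add_mem_relations (hadm k).1 (c k)
  rw [Finset.sum_add_distrib] at hseg
  have := relations.sub_mem (relations.sub_mem (relations.neg_mem hx) hpt) hseg
  convert this using 1
  abel

/-- **Every element of the span has a normal form.** -/
theorem soloInformed_segNF_of_mem_segSpan {x : FormalRep} (hx : x ∈ soloInformedSegSpan) :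
    SoloInformedSegNF x := by
  refine AddSubgroup.closure_induction (p := fun y _ => SoloInformedSegNF y) (fun y hy => ?_)
    (soloInformed_segNF_of_mem_relations relations.zero_mem)
    (fun y z _ _ hy hz => soloInformed_segNF_add hy hz) (fun y _ hy => soloInformed_segNF_neg hy) hx
  rcases hy with (hy | ⟨a, ha, rfl⟩) | ⟨g, c, h, rfl⟩
  · exact soloInformed_segNF_of_mem_relations hy
  · exact soloInformed_segNF_ptRep a ha
  · exact soloInformed_segNF_segRep h

/-! ### The kernel property -/

/-- `eval` of a normal form. -/
theorem soloInformed_eval_ptRep_add_sum {a : ℝ} (ha : IsAlgebraic ℚ a) {K : ℕ} {g c : Fin K → ℂ}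
    (hadm : ∀ k, SoloInformedSegAdm (g k) (c k)) :
    eval (of (soloInformedPtRep a ha) + ∑ k, of (soloInformedSegRep (g k) (c k))) =
      a + ∑ k, (g k * Complex.log (c k)).re := by
  rw [map_add, map_sum, eval_of, soloInformed_value_ptRep]
  congr 1
  exact Finset.sum_congr rfl fun k _ => by rw [eval_of, soloInformed_value_segRep (hadm k)]

/-- **Kernel property of the span.** An element of the span of points and segments with
`eval = 0` is a relation (normal form + the null theorem). [Baker 1975, Thm. 2.1; this work] -/
theorem soloInformed_mem_relations_of_mem_segSpan {x : FormalRep} (hx : x ∈ soloInformedSegSpan)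
    (h0 : eval x = 0) : x ∈ relations := by
  classical
  obtain ⟨a, ha, K, g, c, hadm, hrel⟩ := soloInformed_segNF_of_mem_segSpan hx
  have hker := relations_le_ker_eval_holds hrel
  rw [AddMonoidHom.mem_ker, map_sub, h0, zero_sub, neg_eq_zero,
    soloInformed_eval_ptRep_add_sum ha hadm] at hker
  have hnull := soloInformed_ptRep_add_segRep_sum_mem_relations ha hadm hker
  have := relations.add_mem hrel hnull
  simpa using this

/-- **The period conjecture on the span.** Two representations whose classes lie in the span of
points and segments and whose values agree are KZ-equivalent. [this work] -/
theorem soloInformed_equivalent_of_mem_segSpan {n m : ℕ} {r : IntegralRep n} {r' : IntegralRep m}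
    (hr : of r ∈ soloInformedSegSpan) (hr' : of r' ∈ soloInformedSegSpan)
    (hv : r.value = r'.value) : Equivalent r r' :=
  soloInformed_mem_relations_of_mem_segSpan (soloInformedSegSpan.sub_mem hr hr')
    (by rw [map_sub, eval_of, eval_of, hv, sub_self])

end Summit.KontsevichZagierPeriods.KontsevichZagierPeriods.Theorems
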